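import Literature.NumberTheory.EllipticCurves.RohrlichNonvanishingProofs
import HarnessLib

/-!
# Stub `stub_conjugacy` (line `Sketch` = `kurihara-fourier-support`, crux `PlecticLegs.TwistSupply`)

**Galois conjugacy of primitivity and of a non-vanishing rational combination of character
values.** Let `χ` be a primitive Dirichlet character mod `d` and `k` an exponent coprime to the
order of `χ`. Then

* `χ ^ k` is again primitive: choosing `m` with `(χ ^ k) ^ m = χ`
  (`exists_pow_eq_self_of_coprime`), the conductor of a power divides the conductor
  (`DirichletCharacter.conductor_pow_dvd`) in both directions,
  `cond χ = cond ((χ^k)^m) ∣ cond (χ^k) ∣ cond χ`, so `cond (χ^k) = cond χ = d`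
  (`conjugacy_conductor_pow_of_coprime`);
* for the rational plus symbols `q_b = [b/d]⁺_f ∈ ℚ` of a cusp form `f ∈ S₂(Γ₀(N))`
  (`ratPlusSymbol`), `∑_b χ(b) q_b ≠ 0` implies `∑_b χ^k(b) q_b ≠ 0`: the exponent `m` above is
  coprime to `ord (χ^k) = ord χ` (`conjugacy_exists_pow_pow_eq_self`), so the tree lemma
  `sum_pow_apply_mul_eq_zero_of_coprime` (Rohrlich 1984, §1: a rational polynomial vanishing at
  `e^{2πi/n}` is divisible by `Φ_n`) applied to `χ ^ k` and `m` transports a vanishing of the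
  `χ^k`-sum back to the `χ`-sum.
-/

noncomputable section

set_option linter.dupNamespace false

namespace Summit.BirchSwinnertonDyer.BirchSwinnertonDyer.Theorems

open CongruenceSubgroup Literature.NumberTheory.EllipticCurves
  Literature.NumberTheory.EllipticCurves.ModularForms

open scoped MatrixGroups ModularForm Classical

/-! ### Inverting a coprime exponent -/

/-- **Inverse exponent.** For `k` coprime to the order of `x` there is `m` with `(x ^ k) ^ m = x`
(`exists_pow_eq_self_of_coprime`), and any such `m` is coprime to `ord (x ^ k) = ord x`:
`x ^ (k m) = x ^ 1` gives `k m ≡ 1 (mod ord x)` (`pow_eq_pow_iff_modEq`), hence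
`gcd (k m, ord x) = 1`. -/
theorem conjugacy_exists_pow_pow_eq_self {G : Type*} [Group G] (x : G) {k : ℕ}
    (hk : k.Coprime (orderOf x)) :
    ∃ m : ℕ, (x ^ k) ^ m = x ∧ m.Coprime (orderOf (x ^ k)) := by
  obtain ⟨m, hm⟩ := exists_pow_eq_self_of_coprime hk
  refine ⟨m, hm, ?_⟩
  rw [Nat.Coprime.orderOf_pow (Nat.coprime_comm.mp hk)]
  have h1 : k * m ≡ 1 [MOD orderOf x] := by
    rw [← pow_eq_pow_iff_modEq, pow_mul, hm, pow_one]
  have h2 : (k * m).Coprime (orderOf x) := by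
    rw [Nat.Coprime, h1.gcd_eq, Nat.gcd_one_left]
  exact Nat.Coprime.coprime_mul_left h2

/-! ### Conductors of coprime powers -/

/-- **The conductor is constant along coprime powers**: `cond (χ ^ k) = cond χ` for `k` coprime
to the order of `χ`. With `(χ ^ k) ^ m = χ` (`conjugacy_exists_pow_pow_eq_self`),
`cond χ = cond ((χ^k)^m) ∣ cond (χ^k) ∣ cond χ` by `DirichletCharacter.conductor_pow_dvd` twice. -/
theorem conjugacy_conductor_pow_of_coprime {n : ℕ} (χ : DirichletCharacter ℂ n) {k : ℕ}
    (hk : k.Coprime (orderOf χ)) : (χ ^ k).conductor = χ.conductor := by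
  obtain ⟨m, hm, -⟩ := conjugacy_exists_pow_pow_eq_self χ hk
  refine Nat.dvd_antisymm (DirichletCharacter.conductor_pow_dvd χ k) ?_
  calc χ.conductor = ((χ ^ k) ^ m).conductor := by rw [hm]
    _ ∣ (χ ^ k).conductor := DirichletCharacter.conductor_pow_dvd _ _

/-- **Primitivity along coprime powers** (any level): `χ ^ k` is primitive for `χ` primitive and
`k` coprime to the order of `χ` (`conjugacy_conductor_pow_of_coprime`). -/
theorem conjugacy_isPrimitive_pow_of_coprime {n : ℕ} {χ : DirichletCharacter ℂ n}
    (hχ : χ.IsPrimitive) {k : ℕ} (hk : k.Coprime (orderOf χ)) : (χ ^ k).IsPrimitive := by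
  rw [DirichletCharacter.isPrimitive_def] at hχ ⊢
  rw [conjugacy_conductor_pow_of_coprime χ hk, hχ]

/-! ### Rational combinations of character values along coprime powers -/

/-- **Non-vanishing of a rational combination is Galois invariant**: for `q : ZMod n → ℚ` and `k`
coprime to the order of `χ`, `∑_a χ(a) q_a ≠ 0` implies `∑_a χ^k(a) q_a ≠ 0`. Contrapositive of
the tree lemma `sum_pow_apply_mul_eq_zero_of_coprime` applied to `χ ^ k` and an inverse exponent
`m`, `(χ ^ k) ^ m = χ`, coprime to `ord (χ ^ k)` (`conjugacy_exists_pow_pow_eq_self`). -/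
theorem conjugacy_sum_pow_apply_mul_ne_zero {n : ℕ} [NeZero n] (χ : DirichletCharacter ℂ n)
    (q : ZMod n → ℚ) (h : ∑ a : ZMod n, χ a * q a ≠ 0) {k : ℕ} (hk : k.Coprime (orderOf χ)) :
    ∑ a : ZMod n, (χ ^ k) a * q a ≠ 0 := by
  intro hk0
  obtain ⟨m, hm, hmcop⟩ := conjugacy_exists_pow_pow_eq_self χ hk
  have h0 := sum_pow_apply_mul_eq_zero_of_coprime (χ ^ k) q hk0 hmcop
  rw [hm] at h0
  exact h h0

/-! ### The stub -/

/-- **Galois conjugacy** (registered stub `stub_conjugacy` of line `Sketch`; Shimura; Rohrlich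
1984, §1): for a primitive `χ mod d` and `k` prime to `ord χ`, the power `χ ^ k` is again
primitive (`conjugacy_isPrimitive_pow_of_coprime`), and a non-vanishing rational combination
`∑_b χ(b) [b/d]⁺_f ≠ 0` of the rational plus symbols of `f ∈ S₂(Γ₀(N))` stays non-zero for
`χ ^ k` (`conjugacy_sum_pow_apply_mul_ne_zero`, from the tree lemma
`sum_pow_apply_mul_eq_zero_of_coprime`). -/
theorem stub_conjugacy :
    ∀ (N : ℕ) (f : CuspForm (Gamma0 N) 2) (d : ℕ) [NeZero d] (χ : DirichletCharacter ℂ d)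
      (k : ℕ), χ.IsPrimitive → k.Coprime (orderOf χ) →
      (χ ^ k).IsPrimitive ∧
        ((∑ b : ZMod d, χ b * ((ratPlusSymbol f ((b.val : ℚ) / d) : ℚ) : ℂ)) ≠ 0 →
          (∑ b : ZMod d, (χ ^ k) b * ((ratPlusSymbol f ((b.val : ℚ) / d) : ℚ) : ℂ)) ≠ 0) := by
  intro N f d _ χ k hχ hk
  exact ⟨conjugacy_isPrimitive_pow_of_coprime hχ hk, fun hS ↦
    conjugacy_sum_pow_apply_mul_ne_zero χ (fun b : ZMod d ↦ ratPlusSymbol f ((b.val : ℚ) / d))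
      hS hk⟩

end Summit.BirchSwinnertonDyer.BirchSwinnertonDyer.Theorems

end
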